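import Mathlib
import HarnessLib
import Summits.Ventures.LatticeQCDFlow.Exactness.BestFisherAngle
import Summits.Ventures.LatticeQCDFlow.Exactness.CircleUniformAngle
import Summits.Ventures.LatticeQCDFlow.Exactness.VMFSiteHeatBathGeneral

/-!
# The von Mises law on angles IS the von Mises–Fisher law on the circle `S¹ ⊂ ℝ²`

HONEST FRAMING: exact (Metropolis-corrected) sampling algorithms for lattice gauge theory;
figures of merit are autocorrelation/cost numbers at stated couplings and volumes; no
continuum-physics claim.

Venture `LatticeQCDFlow` (cell pub-lqcd), topic `Exactness`, FANOUT row 9 (eng-latcore, the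
engine `latflow.core`).  NEW WORK of the cell over row 9's `BestFisherAngle.lean` (`vonMisesLawAt κ φ₀`
on `(−π, π]`, the law the engine's link sampler outputs), `CircleUniformAngle.lean` (`circlePt`,
`lintegral_uniformSphere_two`: arc length) and `VMFSiteHeatBathGeneral.lean` (`vmfAt`, here at `n = 0`:
the circle).  Nothing is cited as a fact.  The coordinate dictionary left NOT CLAIMED by
`CPNLinkConditional.lean`:

* `inner_circlePt` — `⟨circlePt φ₀, circlePt ψ⟩ = cos(ψ − φ₀)`;
* **`map_circlePt_vonMisesLawAt`** — `(vonMisesLawAt κ φ₀).map circlePt = (2π / σ(S¹)) • vmfAt 0 κ (circlePt φ₀)`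
  (density `e^{κ cos(ψ−φ₀)} dψ` on angles ↦ density `e^{κ⟨m, x⟩}` against the surface measure of `S¹`,
  `m = circlePt φ₀`);
* **`map_circlePt_vonMisesLawAt_normalized`** — NORMALISED, the two laws agree exactly:
  `((vonMisesLawAt κ φ₀ univ)⁻¹ • vonMisesLawAt κ φ₀).map circlePt = (vmfAt 0 κ m univ)⁻¹ • vmfAt 0 κ m`,
  `m = circlePt φ₀`: the Best–Fisher link draw (`map_bestFisher_link`), read as a point of `S¹`, samples
  exactly the link conditional of `CPNLinkConditional.gibbsDensity_cpnAction_update_link` (`κ = ‖b_e‖`,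
  `m = b_e/‖b_e‖`).

NOT CLAIMED: floating point.
-/

namespace Summit.Ventures.LatticeQCDFlow.Exactness

open MeasureTheory Measure Metric Set Real
open scoped ENNReal InnerProductSpace

/-- `⟨circlePt φ₀, circlePt ψ⟩ = cos(ψ − φ₀)`. -/
theorem inner_circlePt (φ₀ ψ : ℝ) :
    ⟪(circlePt φ₀ : E2), (circlePt ψ : E2)⟫_ℝ = Real.cos (ψ - φ₀) := by
  rw [circlePt_coe, circlePt_coe, PiLp.inner_apply, Fin.sum_univ_two]
  simp only [mk2_apply_zero, mk2_apply_one, RCLike.inner_apply, conj_trivial]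
  rw [Real.cos_sub]

/-- The total arc length of the unit circle is finite and non-zero (as the mass of `volume.toSphere`). -/
theorem toSphere_two_univ_ne :
    ((volume : Measure E2).toSphere univ) ≠ 0 ∧ ((volume : Measure E2).toSphere univ) ≠ ∞ :=
  ⟨toSphere_univ_ne_zero _, measure_ne_top _ _⟩

/-- **Angles ↦ circle**: `(vonMisesLawAt κ φ₀).map circlePt = (2π/σ(S¹)) • vmfAt 0 κ (circlePt φ₀)`. -/
theorem map_circlePt_vonMisesLawAt (κ φ₀ : ℝ) :
    (vonMisesLawAt κ φ₀).map circlePt =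
      (ENNReal.ofReal (2 * π) * ((volume : Measure E2).toSphere univ)⁻¹) • vmfAt 0 κ (circlePt φ₀ : E2) := by
  have hC := toSphere_two_univ_ne
  have hW : Measurable fun x : sphere (0 : E2) 1 => ENNReal.ofReal (Real.exp (κ * ⟪(circlePt φ₀ : E2), (x : E2)⟫_ℝ)) :=
    (measurable_const.mul (measurable_const.inner measurable_subtype_coe)).exp.ennreal_ofReal
  refine Measure.ext_of_lintegral _ fun G hG => ?_
  have hGc : Measurable fun a : ℝ => G (circlePt a) := hG.comp measurable_circlePt
  rw [lintegral_map hG measurable_circlePt, vonMisesLawAt,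
    lintegral_withDensity_eq_lintegral_mul _ (by fun_prop) hGc,
    setLIntegral_congr (Ioo_ae_eq_Ioc (μ := (volume : Measure ℝ))).symm,
    lintegral_smul_measure, vmfAt, lintegral_withDensity_eq_lintegral_mul _ hW hG]
  -- the right side through `uniformSphere` and arc length
  have hU : ((volume : Measure E2).toSphere) = ((volume : Measure E2).toSphere univ) • uniformSphere (volume : Measure E2) := by
    rw [uniformSphere, smul_smul, ENNReal.mul_inv_cancel hC.1 hC.2, one_smul]
  have hT : ∀ f : sphere (0 : E2) 1 → ℝ≥0∞, ∫⁻ x, f x ∂((volume : Measure E2).toSphere) =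
      ((volume : Measure E2).toSphere univ) * ∫⁻ x, f x ∂(uniformSphere (volume : Measure E2)) := by
    intro f
    conv_lhs => rw [hU]
    rw [lintegral_smul_measure, smul_eq_mul]
  rw [hT, lintegral_uniformSphere_two (hW.mul hG), smul_eq_mul,
    ← mul_assoc, mul_assoc (ENNReal.ofReal (2 * π)), ENNReal.inv_mul_cancel hC.1 hC.2, mul_one,
    ← lintegral_const_mul' _ _ ENNReal.ofReal_ne_top]
  refine setLIntegral_congr_fun measurableSet_Ioo fun ψ _ => ?_
  rw [Pi.mul_apply, Pi.mul_apply, inner_circlePt, ← mul_assoc, ← ENNReal.ofReal_mul (by positivity),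
    mul_one_div_cancel (by positivity : (2 : ℝ) * π ≠ 0), ENNReal.ofReal_one, one_mul]

/-- **NORMALISED, THE VON MISES LAW ON ANGLES AND THE VON MISES–FISHER LAW ON THE CIRCLE AGREE**:
`((vonMisesLawAt κ φ₀ ℝ)⁻¹ • vonMisesLawAt κ φ₀).map circlePt = (vmfAt 0 κ m univ)⁻¹ • vmfAt 0 κ m`,
`m = circlePt φ₀`. -/
theorem map_circlePt_vonMisesLawAt_normalized (κ φ₀ : ℝ) :
    ((vonMisesLawAt κ φ₀ univ)⁻¹ • vonMisesLawAt κ φ₀).map circlePt =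
      (vmfAt 0 κ (circlePt φ₀ : E2) univ)⁻¹ • vmfAt 0 κ (circlePt φ₀ : E2) := by
  have hC := toSphere_two_univ_ne
  have hc0 : ENNReal.ofReal (2 * π) * ((volume : Measure E2).toSphere univ)⁻¹ ≠ 0 :=
    mul_ne_zero (by rw [Ne, ENNReal.ofReal_eq_zero, not_le]; positivity) (ENNReal.inv_ne_zero.2 hC.2)
  have hct : ENNReal.ofReal (2 * π) * ((volume : Measure E2).toSphere univ)⁻¹ ≠ ∞ :=
    ENNReal.mul_ne_top ENNReal.ofReal_ne_top (ENNReal.inv_ne_top.2 hC.1)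
  have huniv : vonMisesLawAt κ φ₀ univ =
      (ENNReal.ofReal (2 * π) * ((volume : Measure E2).toSphere univ)⁻¹) * vmfAt 0 κ (circlePt φ₀ : E2) univ := by
    have h := congrArg (fun μ : Measure (sphere (0 : E2) 1) => μ univ) (map_circlePt_vonMisesLawAt κ φ₀)
    simp only [Measure.map_apply measurable_circlePt MeasurableSet.univ, preimage_univ, Measure.smul_apply,
      smul_eq_mul] at h
    exact h
  rw [Measure.map_smul, map_circlePt_vonMisesLawAt, huniv, smul_smul,
    ENNReal.mul_inv (Or.inl hc0) (Or.inl hct), mul_assoc, mul_comm ((vmfAt 0 κ _ univ)⁻¹), ← mul_assoc,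
    ENNReal.inv_mul_cancel hc0 hct, one_mul]

end Summit.Ventures.LatticeQCDFlow.Exactness
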